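import Literature.NumberTheory.Automorphic.BLGGT2014PotentialAutomorphy
import HarnessLib

/-!
# Potential automorphy of a single `l`-adic representation over a totally real field, WITH the
# `F^{avoid}` clause: the residual irreducibility over `F'(ζ_l)` is preserved
# (Barnet-Lamb–Gee–Geraghty–Taylor 2014, Cor. 4.5.2 with Thm. 4.5.1; Patrikis–Taylor 2015, proof of Thm. 2.1)

Topic `Literature/NumberTheory/Automorphic`; story of the accepted `BLGGT2014PotentialAutomorphy`
(`BLGGT2014_thmC_potentialAutomorphy`, whose module docstring lists among the DROPPED parts of the
printed statement "the linear disjointness from an auxiliary `F^{avoid}` (Thm. 4.5.1)" and whose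
`-- TODO(general form)` asks for it).  One NAMED FACT (D-0014), `BLGGT2014_thmC_potentialAutomorphy_avoid`:
the accepted statement VERBATIM (hypotheses (1)–(4), conclusion: `F'/F` finite Galois totally real,
`r|_{Γ_{F'}}` semisimple and HLTT-compatible with a regular algebraic cuspidal `π` of `GL_n(𝔸_{F'})`)
with ONE MORE conjunct in the conclusion: `r̄|_{Γ_{F'(ζ_l)}}` is still (absolutely) irreducible —
`((r.restrictField F').restrictField (CyclotomicField l F')).IsResiduallyAbsIrreducible`.

## Why this is the printed theorem (held text arXiv:1010.2561, pp. 30–31, read 2026-08-17)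

* **Theorem 4.5.1** (p. 30, CM base `F`, any finite set of `r_i`): among the data "Let `F^{avoid}/F` be a
  finite Galois extension", among the conclusions "`F'` is linearly disjoint from `F^{avoid}` over `F`".
* **Corollary 4.5.2** (p. 30, totally real base `F⁺`, the accepted Theorem C) is deduced from it in
  print by: "Choose `F/F⁺` a totally imaginary quadratic extension in which all the places lying over
  `l` split completely, and which is linearly disjoint from `(F̄⁺)^{ker ad r̄}(ζ_l)` over `F⁺`.  The
  representation `r|_{G_F}` satisfies the hypotheses of Theorem 4.5.1, so that there is a finite Galois
  CM extension `F'/F` such that `(r|_{G_{F'}}, μ|_{G_{F'^+}})` is automorphic of level prime to `l`.  By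
  Lemma 1.5 of [BLGHT], `(r|_{G_{F'^+}}, μ|_{G_{F'^+}})` is also automorphic".  Running the same proof
  with Theorem 4.5.1's `F^{avoid}` taken to contain `F · (F̄⁺)^{ker r̄}(ζ_l)` (and `F` chosen linearly
  disjoint from `(F̄⁺)^{ker r̄}(ζ_l)` as well) makes the totally real `F'^+` linearly disjoint from
  `(F̄⁺)^{ker r̄}(ζ_l)` over `F⁺`, so that `r̄(G_{F'^+(ζ_l)}) = r̄(G_{F⁺(ζ_l)})` and hypothesis (4) survives
  to `F'^+`.  This is EXACTLY how the theorem is used in print: Patrikis–Taylor 2015, proof of Thm. 2.1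
  (held text arXiv:1307.1640 p. 9): "Replace `F^{avoid}` by its compositum with the `F̄^{ker r̄_{i,λ_i,j}}(ζ_{l_i})`
  for all `i, j`.  Now apply theorem 4.5.1 of [blggt].  We obtain a CM extension `F'/F` with `F'/F₀`
  Galois and `F'` linearly disjoint from `F^{avoid}` over `F`".
  -- TODO(general form): the conclusion "`F'` linearly disjoint over `F` from ANY given finite Galois `F^{avoid}`"
  -- (of which the residual clause below is the consequence for `F^{avoid} ⊇ F̄^{ker r̄}(ζ_l)`), and the CM case.

Wanted by the crux `stmt-Langlands-17000` (`NonParallelVoid.TwistedInductionParallel`, line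
`symmetrise-pd-split`): the Arthur–Clozel descent (stub 3') of the potentially automorphic induced twist
`I = Ind_E^K(ρ|_E ⊗ χ)` needs `I|_{Γ_{K'}}` IRREDUCIBLE (cross-matching of the two `GL₂` constituents over
`E K'`), which the accepted avoid-free statement cannot give (`K'` might meet the field cut out by `Ī`).

## References

* [BarnetlambEtAl2014] T. Barnet-Lamb, T. Gee, D. Geraghty, R. Taylor, *Potential automorphy and change
  of weight*, Ann. of Math. 179 (2014): Thm. 4.5.1 and Cor. 4.5.2 with its proof (pp. 30–31 of
  arXiv:1010.2561), Theorem C (Introduction).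
* [PatrikisTaylor2015] S. Patrikis, R. Taylor, *Automorphy and irreducibility of some l-adic
  representations*, Compos. Math. 151 (2015), proof of Thm. 2.1 (arXiv:1307.1640 p. 9).
* [BarnetlambEtAl2011] T. Barnet-Lamb, D. Geraghty, M. Harris, R. Taylor, Publ. RIMS 47 (2011), Lemma 1.5.

`lean search 'potentialAutomorphy_avoid|thmC.*avoid'` (2026-08-17): no prior declaration.
-/

noncomputable section

open scoped MatrixGroups Matrix NumberField
open NumberField IsDedekindDomain Field Filter

namespace Literature.NumberTheory.Automorphic

open Literature.NumberTheory.GaloisRepresentations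

/-- **Barnet-Lamb–Gee–Geraghty–Taylor 2014, Theorem C (= Cor. 4.5.2 via Thm. 4.5.1) with the
`F^{avoid}` clause in the form "the residual irreducibility over `F'(ζ_l)` is preserved".**  The accepted
`BLGGT2014_thmC_potentialAutomorphy` verbatim — `F` totally real, `0 < n`, `2(n+1) ≤ l`,
`ι : ℚ̄_l ≃ ℂ`, `r : Γ_F → GL_n(ℚ̄_l)` (1) unramified almost everywhere, (2) odd essentially self-dual
(`GSp` totally odd or `GO` totally even, on matrices), (3) de Rham with `n` distinct labelled weights and
potentially diagonalizable for every instance of compatible crystalline extension data over Fontaine's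
pinned datum at every `v ∣ l`, (4) `r̄|_{Γ_{F(ζ_l)}}` absolutely irreducible ⟹ a finite Galois totally real
`F'/F` with `r|_{Γ_{F'}}` semisimple and HLTT-compatible with a regular algebraic cuspidal `π` of
`GL_n(𝔸_{F'})` — AND `r̄|_{Γ_{F'(ζ_l)}}` absolutely irreducible
(`IsResiduallyAbsIrreducible` of `(r|_{Γ_{F'}})|_{Γ_{F'(ζ_l)}}`), obtained in print by taking Theorem 4.5.1's
`F^{avoid} ⊇ F̄^{ker r̄}(ζ_l)` in the proof of Cor. 4.5.2 (Patrikis–Taylor 2015, proof of Thm. 2.1, verbatim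
usage).  Named fact (D-0014); users take `(h : BLGGT2014_thmC_potentialAutomorphy_avoid)`; it implies the
accepted avoid-free fact (`BLGGT2014_thmC_potentialAutomorphy_avoid.thmC`).
[cite: BarnetlambEtAl2014, Cor. 4.5.2 (proof, p. 30) with Thm. 4.5.1 (`F^{avoid}` clause)]
[cite: PatrikisTaylor2015, proof of Thm. 2.1 (arXiv:1307.1640 p. 9)] -/
def BLGGT2014_thmC_potentialAutomorphy_avoid : Prop :=
  ∀ (F : Type) [Field F] [NumberField F], IsTotallyReal F →
    ∀ (n : ℕ), 0 < n → ∀ (l : ℕ) [Fact l.Prime], 2 * (n + 1) ≤ l →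
    ∀ (ι : PadicAlgCl l ≃+* ℂ) (r : FramedGaloisRep F (PadicAlgCl l) n),
      (∀ᶠ v : HeightOneSpectrum (𝓞 F) in cofinite, r.IsUnramifiedAt v) →
      ((∃ (J : Matrix (Fin n) (Fin n) (PadicAlgCl l)) (μ : absoluteGaloisGroup F →* (PadicAlgCl l)ˣ),
          Jᵀ = -J ∧ IsUnit J.det ∧
          (∀ g : absoluteGaloisGroup F, (r g).val.transpose * J * (r g).val = (μ g : PadicAlgCl l) • J) ∧
          ∀ (φ : F →+* ℝ) (c : absoluteGaloisGroup F), IsComplexConjugation φ c → μ c = -1) ∨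
        (∃ (J : Matrix (Fin n) (Fin n) (PadicAlgCl l)) (μ : absoluteGaloisGroup F →* (PadicAlgCl l)ˣ),
          J.IsSymm ∧ IsUnit J.det ∧
          (∀ g : absoluteGaloisGroup F, (r g).val.transpose * J * (r g).val = (μ g : PadicAlgCl l) • J) ∧
          ∀ (φ : F →+* ℝ) (c : absoluteGaloisGroup F), IsComplexConjugation φ c → μ c = 1)) →
      (∀ (v : HeightOneSpectrum (𝓞 F)) (hv : ((l : ℕ) : 𝓞 F) ∈ v.asIdeal),
        (PAdicHodge.fontainePstAdicCompletion v l hv).IsDeRhamFramed (r.toLocal v) ∧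
        (letI := (PAdicHodge.fontainePstAdicCompletion v l hv).algebra
         (∀ τ : v.adicCompletion F →ₐ[ℚ_[l]] PadicAlgCl l,
            (let M := r.labelledHodgeTateWeightsAt v
               (PAdicHodge.fontainePstAdicCompletion v l hv).algebra
               (PAdicHodge.fontainePstAdicCompletion v l hv).𝔅 τ.toRingHom
             M.Nodup ∧ Multiset.card M = n)) ∧
         Nonempty (PstCrystallineExtensionData (PAdicHodge.fontainePstAdicCompletion v l hv)) ∧
         ∀ 𝔈 : PstCrystallineExtensionData (PAdicHodge.fontainePstAdicCompletion v l hv),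
           IsPotentiallyDiagonalizable 𝔈.𝔅 (r.toLocal v))) →
      (r.restrictField (CyclotomicField l F)).IsResiduallyAbsIrreducible →
      ∃ (F' : Type) (_ : Field F') (_ : NumberField F') (_ : Algebra F F'),
        IsGalois F F' ∧ IsTotallyReal F' ∧
          (r.restrictField F').toGaloisRep.IsSemisimple ∧
          ((r.restrictField F').restrictField (CyclotomicField l F')).IsResiduallyAbsIrreducible ∧
          ∃ (hcpt : isCompact_glFiniteIntegralLevel n F') (π : CuspidalAutomorphicRepData n F' hcpt),
            π.1.IsRegularAlgebraic ∧ HarrisLanTaylorThorne2016.IsCompatible π.1 ι (r.restrictField F')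

/-- The avoid form implies the accepted avoid-free Theorem C (forget the residual conjunct). [folklore] -/
theorem BLGGT2014_thmC_potentialAutomorphy_avoid.thmC (h : BLGGT2014_thmC_potentialAutomorphy_avoid) :
    BLGGT2014_thmC_potentialAutomorphy := by
  intro F _ _ hF n hn l _ hl ι r h1 h2 h3 h4
  obtain ⟨F', _, _, _, hGal, hF', hss, -, hcpt, π, hreg, hcompat⟩ := h F hF n hn l hl ι r h1 h2 h3 h4
  exact ⟨F', inferInstance, inferInstance, inferInstance, hGal, hF', hss, hcpt, π, hreg, hcompat⟩

end Literature.NumberTheory.Automorphic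

end
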